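import Mathlib
import HarnessLib

/-!
# The rank of a finitely generated module read modulo a prime element

Topic `Algebra/Module`; namespace `Literature.Algebra.Module`; THEOREMS ONLY (no definition, no
named fact, no `sorry`).

Let `R` be a Noetherian integral domain, `t ∈ R` a non-zero PRIME ELEMENT (the principal ideal
`(t)` is prime), `R' = R/(t)` (again a domain) and `X` a finitely generated `R`-module. The
multiplication-by-`t` map `X → X` has kernel `X[t]` and cokernel `X/tX`, both `R'`-modules, and

  `rank_R X = rank_{R'} (X/tX) − rank_{R'} (X[t])`       (`finrank_eq_finrank_quotient_sub_finrank_torsionBy`).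

(Both sides are additive in short exact sequences — the right side by the snake lemma for
multiplication by `t` — and agree on every `R/𝔮`, `𝔮` prime: for `t ∈ 𝔮` both vanish; for
`t ∉ 𝔮 ≠ 0` the module `R/(𝔮 + (t))` is `R'`-torsion because `𝔮 ⊄ (t)` by Krull's intersection
theorem; for `𝔮 = 0` both are `1`; a finitely generated module has a prime filtration.) This is the
algebraic input of the inductive step "`Λ = ℤ_p⟦T₁,…,T_m⟧ ↦ Λ/(T_m)`" in corank computations for
Iwasawa modules (Greenberg, *On the structure of certain Galois cohomology groups* (2006), §3–§4:
Props. 3.2, 4.1, 4.2 are proved by such reductions), where it is applied to Pontryagin duals.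

Also here: the alternating sum of ranks along a six-term exact sequence vanishes
(`finrank_alternatingSum_six_eq_zero`), and `exists_mem_and_not_mem_span_singleton` (a non-zero
prime not containing the prime element `t` is not contained in `(t)`).

Only the main theorem is public; the helpers (`private`) are rank–nullity bookkeeping.

## References
* R. Greenberg, *On the structure of certain Galois cohomology groups*, Doc. Math. Extra Vol.
  Coates (2006) 335–391, §2 A Prop. 2.1 / Remark 2.1.3 (pp. 347–348: ranks and coranks under
  specialisation `X ↦ X/PX`, `A ↦ A[P]`), §4 A p. 368 (reduction of the Krull dimension by a
  height-one prime). [Greenberg2006]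
* N. Bourbaki, *Algèbre commutative* VII §4 (ranks of finitely generated modules over Noetherian
  domains, additivity); standard background.
-/

namespace Literature.Algebra.Module

open _root_.Module Submodule Function

universe u v

/-! ## §1. Ranks along exact sequences -/

section Exact

variable {A : Type u} [CommRing A] [IsDomain A]

/-- Rank–nullity over a domain, `finrank` form: `rank M = rank (ker φ) + rank (im φ)` for a linear
map out of a finitely generated module. [folklore] -/
private theorem finrank_eq_finrank_ker_add_finrank_range {M N : Type v} [AddCommGroup M] [Module A M]
    [AddCommGroup N] [Module A N] [Module.Finite A M] (φ : M →ₗ[A] N) :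
    finrank A M = finrank A (LinearMap.ker φ) + finrank A (LinearMap.range φ) := by
  rw [← φ.quotKerEquivRange.finrank_eq, add_comm, Submodule.finrank_quotient_add_finrank]

/-- **The alternating sum of ranks along a six-term exact sequence of finitely generated modules
over a domain vanishes**: `0 → M₁ → M₂ → M₃ → M₄ → M₅ → M₆ → 0` exact gives
`rk M₁ − rk M₂ + rk M₃ − rk M₄ + rk M₅ − rk M₆ = 0`. [folklore] -/
private theorem finrank_alternatingSum_six_eq_zero
    {M₁ M₂ M₃ M₄ M₅ M₆ : Type v}
    [AddCommGroup M₁] [Module A M₁] [Module.Finite A M₁] [AddCommGroup M₂] [Module A M₂]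
    [Module.Finite A M₂] [AddCommGroup M₃] [Module A M₃] [Module.Finite A M₃] [AddCommGroup M₄]
    [Module A M₄] [Module.Finite A M₄] [AddCommGroup M₅] [Module A M₅] [Module.Finite A M₅]
    [AddCommGroup M₆] [Module A M₆] [Module.Finite A M₆]
    (φ₁ : M₁ →ₗ[A] M₂) (φ₂ : M₂ →ₗ[A] M₃) (φ₃ : M₃ →ₗ[A] M₄) (φ₄ : M₄ →ₗ[A] M₅)
    (φ₅ : M₅ →ₗ[A] M₆) (h₁ : Injective φ₁) (h₁₂ : Exact φ₁ φ₂) (h₂₃ : Exact φ₂ φ₃)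
    (h₃₄ : Exact φ₃ φ₄) (h₄₅ : Exact φ₄ φ₅) (h₅ : Surjective φ₅) :
    (finrank A M₁ : ℤ) - finrank A M₂ + finrank A M₃ - finrank A M₄ + finrank A M₅ -
      finrank A M₆ = 0 := by
  have e₁ := finrank_eq_finrank_ker_add_finrank_range φ₁
  have e₂ := finrank_eq_finrank_ker_add_finrank_range φ₂
  have e₃ := finrank_eq_finrank_ker_add_finrank_range φ₃
  have e₄ := finrank_eq_finrank_ker_add_finrank_range φ₄
  have e₅ := finrank_eq_finrank_ker_add_finrank_range φ₅
  have k₁ : finrank A (LinearMap.ker φ₁) = 0 := by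
    rw [LinearMap.ker_eq_bot.mpr h₁, finrank_bot]
  have k₂ : finrank A (LinearMap.ker φ₂) = finrank A (LinearMap.range φ₁) := by
    rw [LinearMap.exact_iff.mp h₁₂]
  have k₃ : finrank A (LinearMap.ker φ₃) = finrank A (LinearMap.range φ₂) := by
    rw [LinearMap.exact_iff.mp h₂₃]
  have k₄ : finrank A (LinearMap.ker φ₄) = finrank A (LinearMap.range φ₃) := by
    rw [LinearMap.exact_iff.mp h₃₄]
  have k₅ : finrank A (LinearMap.ker φ₅) = finrank A (LinearMap.range φ₄) := by
    rw [LinearMap.exact_iff.mp h₄₅]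
  have r₅ : finrank A (LinearMap.range φ₅) = finrank A M₆ := by
    rw [LinearMap.range_eq_top.mpr h₅, finrank_top]
  omega

omit [IsDomain A] in
/-- A module killed by a non-zero scalar has rank `0`. [folklore] -/
private theorem finrank_eq_zero_of_smul_eq_zero {M : Type v} [AddCommGroup M] [Module A M] {a : A}
    (ha : a ≠ 0) (h : ∀ x : M, a • x = 0) : finrank A M = 0 :=
  finrank_eq_zero_of_rank_eq_zero (rank_eq_zero_iff.mpr fun x ↦ ⟨a, ha, h x⟩)

end Exact

/-! ## §2. A non-zero prime not containing the prime element `t` is not inside `(t)` -/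

section Krull

variable {R : Type u} [CommRing R] [IsNoetherianRing R] [IsDomain R]

/-- In a Noetherian domain, if `(t) ≠ R` and `𝔮` is a prime ideal with `t ∉ 𝔮` and `𝔮 ≠ 0`, then
some `s ∈ 𝔮` lies outside `(t)`: otherwise every `q ∈ 𝔮` is divisible by `t` with quotient again in
`𝔮` (primality), hence `q ∈ ⋂ₙ (tⁿ) = 0` by Krull's intersection theorem. [folklore] -/
private theorem exists_mem_and_not_mem_span_singleton {t : R} (ht : Ideal.span {t} ≠ ⊤)
    {𝔮 : Ideal R} (h𝔮 : 𝔮.IsPrime) (htq : t ∉ 𝔮) (hq0 : 𝔮 ≠ ⊥) :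
    ∃ s ∈ 𝔮, s ∉ Ideal.span {t} := by
  by_contra hcon
  push Not at hcon
  -- every element of `𝔮` is divisible by every power of `t`
  have hpow : ∀ (n : ℕ) (q : R), q ∈ 𝔮 → q ∈ Ideal.span {t ^ n} := by
    intro n
    induction n with
    | zero => intro q _; simp
    | succ n ih =>
      intro q hq
      obtain ⟨q₁, rfl⟩ := Ideal.mem_span_singleton'.mp (hcon q hq)
      have hq₁ : q₁ ∈ 𝔮 := ((h𝔮.mem_or_mem (by simpa [mul_comm] using hq)).resolve_right htq)
      obtain ⟨q₂, rfl⟩ := Ideal.mem_span_singleton'.mp (ih q₁ hq₁)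
      exact Ideal.mem_span_singleton'.mpr ⟨q₂, by ring⟩
  obtain ⟨q, hq, hq0'⟩ := 𝔮.ne_bot_iff.mp hq0
  have hmem : q ∈ ⨅ n : ℕ, Ideal.span {t} ^ n := by
    rw [Ideal.mem_iInf]
    intro n
    rw [Ideal.span_singleton_pow]
    exact hpow n q hq
  rw [Ideal.iInf_pow_eq_bot_of_isDomain _ ht] at hmem
  exact hq0' hmem

end Krull

/-! ## §3. The rank formula `rank_R X = rank_{R/(t)} (X/tX) − rank_{R/(t)} (X[t])` -/

section RankFormula

variable {R : Type u} [CommRing R]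

/-- The quotient map `R → R/(t)` (as `algebraMap`) is surjective. [folklore] -/
private theorem algebraMap_quotient_span_singleton_surjective (t : R) :
    Surjective (algebraMap R (R ⧸ Ideal.span {t})) :=
  Ideal.Quotient.mk_surjective

/-- On a module `N ≃ R/𝔮`, every `q ∈ 𝔮` acts as `0`. [folklore] -/
private theorem smul_eq_zero_of_linearEquiv_quotient {N : Type v} [AddCommGroup N] [Module R N]
    {𝔮 : Ideal R} (e : N ≃ₗ[R] R ⧸ 𝔮) {q : R} (hq : q ∈ 𝔮) (x : N) : q • x = 0 := by
  apply e.injective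
  rw [map_smul, map_zero, ← IsScalarTower.algebraMap_smul (R ⧸ 𝔮) q (e x), smul_eq_mul,
    Ideal.Quotient.algebraMap_eq, Ideal.Quotient.eq_zero_iff_mem.mpr hq, zero_mul]

/-- `R/𝔮` for `t ∉ 𝔮` has no `t`-torsion (transported along `N ≃ R/𝔮`). [folklore] -/
private theorem torsionBy_eq_zero_of_linearEquiv_quotient {t : R} {N : Type v} [AddCommGroup N] [Module R N]
    {𝔮 : Ideal R} (h𝔮 : 𝔮.IsPrime) (e : N ≃ₗ[R] R ⧸ 𝔮) (htq : t ∉ 𝔮)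
    (x : torsionBy R N t) : x = 0 := by
  obtain ⟨x, hx⟩ := x
  rw [mem_torsionBy_iff] at hx
  obtain ⟨r, hr⟩ := Ideal.Quotient.mk_surjective (e x)
  have h0 : t • e x = 0 := by rw [← map_smul, hx, map_zero]
  rw [← hr, ← IsScalarTower.algebraMap_smul (R ⧸ 𝔮) t, smul_eq_mul, Ideal.Quotient.algebraMap_eq,
    ← map_mul, Ideal.Quotient.eq_zero_iff_mem] at h0
  have hr𝔮 : r ∈ 𝔮 := (h𝔮.mem_or_mem h0).resolve_left htq
  have hex : e x = 0 := by rw [← hr, Ideal.Quotient.eq_zero_iff_mem.mpr hr𝔮]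
  exact Subtype.ext ((map_eq_zero_iff e e.injective).mp hex)

variable [IsNoetherianRing R] [IsDomain R] {t : R}

/-- **The rank of a finitely generated module over a Noetherian domain, read modulo a non-zero
prime element `t`**: `rank_R X = rank_{R/(t)} (X/tX) − rank_{R/(t)} X[t]` (both `X/tX = X/(t)X` and
the `t`-torsion `X[t]` being modules over the domain `R/(t)`).  Proof: prime filtration of `X`
(`IsNoetherianRing.induction_on_isQuotientEquivQuotientPrime`); on `R/𝔮` both sides are `0`
(`t ∈ 𝔮`; or `t ∉ 𝔮 ≠ 0`, using `exists_mem_and_not_mem_span_singleton`) or `1` (`𝔮 = 0`); both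
sides are additive in short exact sequences, the right one by the snake lemma for multiplication by
`t` (Mathlib `SnakeLemma.δ'`).  This is the EXACT form, for a principal height-one prime
`P = (t)`, of Greenberg's specialisation inequality `rank_{R/P}(X/PX) ≥ rank_R X` with equality off
a closed set (§2 A, Prop. 2.1 and Remark 2.1.3 (1): "corank_{R/P}(A[P]) = rank_{R/P}(X/PX) … ≥ r …
= r if and only if I ⊄ P"), and is the algebra of his reduction "to the case where the Krull
dimension of Λ is 1 … (Λ/P) is also a formal power series ring, but with Krull dimension reduced by
1" in the proof of Props. 4.1/4.2 (p. 368 L34–52); here the defect is identified as `rank_{R/P} X[t]`.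
[cite: Greenberg2006, §2 A Prop. 2.1 with Remark 2.1.3 (1) (pp. 347–348); §4 A, proof of Props. 4.1–4.2 (p. 368 L34–52)] -/
theorem finrank_eq_finrank_quotient_sub_finrank_torsionBy (ht0 : t ≠ 0)
    (ht : (Ideal.span {t}).IsPrime) (X : Type v) [AddCommGroup X] [Module R X]
    [hX : Module.Finite R X] :
    (Module.finrank R X : ℤ) =
      (Module.finrank (R ⧸ Ideal.span {t}) (X ⧸ (Ideal.span {t} • ⊤ : Submodule R X)) : ℤ) -
        Module.finrank (R ⧸ Ideal.span {t}) (torsionBy R X t) := by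
  haveI : IsDomain (R ⧸ Ideal.span {t}) := (Ideal.Quotient.isDomain_iff_prime _).mpr ht
  have hs := algebraMap_quotient_span_singleton_surjective t
  induction hX using IsNoetherianRing.induction_on_isQuotientEquivQuotientPrime R with
  | subsingleton N =>
    simp [Module.finrank_zero_of_subsingleton]
  | quotient N 𝔭 e =>
    by_cases htq : t ∈ 𝔭.asIdeal
    · -- `t` kills `N`: `rank_R N = 0`, and `N/tN = N = N[t]`
      have hkill : ∀ x : N, t • x = 0 := smul_eq_zero_of_linearEquiv_quotient e htq
      have h1 : Module.finrank R N = 0 := finrank_eq_zero_of_smul_eq_zero ht0 hkill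
      have hbot : (Ideal.span {t} • ⊤ : Submodule R N) = ⊥ := by
        rw [Submodule.ideal_span_singleton_smul, eq_bot_iff]
        intro x hx
        obtain ⟨y, -, rfl⟩ := (Submodule.mem_smul_pointwise_iff_exists _ _ _).mp hx
        exact (Submodule.mem_bot R).mpr (hkill y)
      let φ : torsionBy R N t →ₗ[R] N ⧸ (Ideal.span {t} • ⊤ : Submodule R N) :=
        (Ideal.span {t} • ⊤ : Submodule R N).mkQ ∘ₗ (torsionBy R N t).subtype
      have hφ : Bijective φ := by
        constructor
        · intro x y hxy
          have : ((x : N) - y) ∈ (Ideal.span {t} • ⊤ : Submodule R N) := by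
            rw [← Submodule.Quotient.eq]; exact hxy
          rw [hbot, Submodule.mem_bot, sub_eq_zero] at this
          exact Subtype.ext this
        · intro q
          obtain ⟨x, rfl⟩ := Submodule.mkQ_surjective _ q
          exact ⟨⟨x, (mem_torsionBy_iff t x).mpr (hkill x)⟩, rfl⟩
      have h2 := (LinearEquiv.ofBijective (φ.extendScalarsOfSurjective hs) hφ).finrank_eq
      rw [h1, ← h2]; simp
    · have htors : ∀ x : torsionBy R N t, x = 0 :=
        torsionBy_eq_zero_of_linearEquiv_quotient 𝔭.isPrime e htq
      haveI : Subsingleton (torsionBy R N t) := ⟨fun a b => by rw [htors a, htors b]⟩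
      rw [Module.finrank_zero_of_subsingleton (M := torsionBy R N t)]
      by_cases hq0 : 𝔭.asIdeal = ⊥
      · -- `N ≃ R`: both ranks are `1`
        let e' : N ≃ₗ[R] R := e.trans (Submodule.quotEquivOfEqBot _ hq0)
        have h1 : Module.finrank R N = 1 := by rw [e'.finrank_eq, Module.finrank_self]
        have hmap : Submodule.map (e' : N →ₗ[R] R) (Ideal.span {t} • ⊤ : Submodule R N) =
            (Ideal.span {t} • ⊤ : Submodule R R) := by
          rw [Submodule.map_smul'', Submodule.map_top, LinearEquiv.range]
        have htop : (Ideal.span {t} • ⊤ : Submodule R R) = Ideal.span {t} := by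
          rw [Ideal.smul_eq_mul, Ideal.mul_top]
        let ψ : (N ⧸ (Ideal.span {t} • ⊤ : Submodule R N)) ≃ₗ[R] (R ⧸ Ideal.span {t}) :=
          (Submodule.Quotient.equiv _ _ e' hmap).trans (Submodule.quotEquivOfEq _ _ htop)
        have h2 := (ψ.extendScalarsOfSurjective hs).finrank_eq
        rw [h1, h2, Module.finrank_self]; simp
      · -- `𝔮 ≠ 0`, `t ∉ 𝔮`: both ranks are `0`
        obtain ⟨q, hq, hqne⟩ := (Submodule.ne_bot_iff _).mp hq0
        have h1 : Module.finrank R N = 0 :=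
          finrank_eq_zero_of_smul_eq_zero hqne (smul_eq_zero_of_linearEquiv_quotient e hq)
        obtain ⟨s, hs𝔮, hst⟩ :=
          exists_mem_and_not_mem_span_singleton ht.ne_top 𝔭.isPrime htq hq0
        have hsne : algebraMap R (R ⧸ Ideal.span {t}) s ≠ 0 := by
          rwa [Ideal.Quotient.algebraMap_eq, Ne, Ideal.Quotient.eq_zero_iff_mem]
        have h2 : Module.finrank (R ⧸ Ideal.span {t})
            (N ⧸ (Ideal.span {t} • ⊤ : Submodule R N)) = 0 := by
          refine finrank_eq_zero_of_smul_eq_zero hsne fun y => ?_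
          obtain ⟨x, rfl⟩ := Submodule.mkQ_surjective _ y
          rw [IsScalarTower.algebraMap_smul, Submodule.mkQ_apply, ← Submodule.Quotient.mk_smul,
            smul_eq_zero_of_linearEquiv_quotient e hs𝔮, Submodule.Quotient.mk_zero]
        rw [h1, h2]; simp
  | exact N₁ N₂ N₃ f g hf hg hfg E₁ E₃ =>
    -- `rank_R` is additive
    have hR : (Module.finrank R N₂ : ℤ) = Module.finrank R N₁ + Module.finrank R N₃ := by
      rw [finrank_eq_finrank_ker_add_finrank_range g, LinearMap.exact_iff.mp hfg,
        ← (LinearEquiv.ofInjective f hf).finrank_eq, LinearMap.range_eq_top.mpr hg, finrank_top]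
      push_cast; ring
    -- the snake diagram for multiplication by `t`
    let i₁ : N₁ →ₗ[R] N₁ := t • LinearMap.id
    let i₂ : N₂ →ₗ[R] N₂ := t • LinearMap.id
    let i₃ : N₃ →ₗ[R] N₃ := t • LinearMap.id
    have h₁ : f ∘ₗ i₁ = i₂ ∘ₗ f := by ext x; simp [i₁, i₂]
    have h₂ : g ∘ₗ i₂ = i₃ ∘ₗ g := by ext x; simp [i₂, i₃]
    have hι : ∀ {N : Type v} [AddCommGroup N] [Module R N],
        Exact (torsionBy R N t).subtype (t • LinearMap.id : N →ₗ[R] N) := by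
      intro N _ _ x
      constructor
      · intro hx
        exact ⟨⟨x, (mem_torsionBy_iff t x).mpr (by simpa using hx)⟩, rfl⟩
      · rintro ⟨y, rfl⟩
        simp only [Submodule.subtype_apply, LinearMap.smul_apply, LinearMap.id_coe, id_eq]
        exact (mem_torsionBy_iff t (y : N)).mp y.2
    have hπ : ∀ {N : Type v} [AddCommGroup N] [Module R N],
        Exact (t • LinearMap.id : N →ₗ[R] N) (Ideal.span {t} • ⊤ : Submodule R N).mkQ := by
      intro N _ _ x
      rw [Submodule.mkQ_apply, Submodule.Quotient.mk_eq_zero, Submodule.ideal_span_singleton_smul,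
        Submodule.mem_smul_pointwise_iff_exists]
      constructor
      · rintro ⟨b, -, rfl⟩; exact ⟨b, by simp⟩
      · rintro ⟨b, rfl⟩; exact ⟨b, Submodule.mem_top, by simp⟩
    -- restrictions to the `t`-torsion and induced maps on the quotients
    have hres : ∀ {N N' : Type v} [AddCommGroup N] [Module R N] [AddCommGroup N'] [Module R N']
        (φ : N →ₗ[R] N'), ∀ x ∈ torsionBy R N t, φ x ∈ torsionBy R N' t := by
      intro N N' _ _ _ _ φ x hx
      rw [mem_torsionBy_iff] at hx ⊢
      rw [← map_smul, hx, map_zero]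
    have hq : ∀ {N N' : Type v} [AddCommGroup N] [Module R N] [AddCommGroup N'] [Module R N']
        (φ : N →ₗ[R] N'), (Ideal.span {t} • ⊤ : Submodule R N) ≤
          Submodule.comap φ (Ideal.span {t} • ⊤ : Submodule R N') := by
      intro N N' _ _ _ _ φ
      rw [← Submodule.map_le_iff_le_comap, Submodule.map_smul'']
      exact Submodule.smul_mono le_rfl le_top
    let F₀ : torsionBy R N₁ t →ₗ[R] torsionBy R N₂ t := f.restrict (hres f)
    let F : torsionBy R N₂ t →ₗ[R] torsionBy R N₃ t := g.restrict (hres g)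
    let G : (N₁ ⧸ (Ideal.span {t} • ⊤ : Submodule R N₁)) →ₗ[R]
        (N₂ ⧸ (Ideal.span {t} • ⊤ : Submodule R N₂)) := Submodule.mapQ _ _ f (hq f)
    let G₂ : (N₂ ⧸ (Ideal.span {t} • ⊤ : Submodule R N₂)) →ₗ[R]
        (N₃ ⧸ (Ideal.span {t} • ⊤ : Submodule R N₃)) := Submodule.mapQ _ _ g (hq g)
    have hF : g ∘ₗ (torsionBy R N₂ t).subtype = (torsionBy R N₃ t).subtype ∘ₗ F := by
      ext x; rfl
    have hG : G ∘ₗ (Ideal.span {t} • ⊤ : Submodule R N₁).mkQ =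
        (Ideal.span {t} • ⊤ : Submodule R N₂).mkQ ∘ₗ f := by
      ext x; rfl
    let δ := SnakeLemma.δ' i₁ i₂ i₃ f g hfg f g hfg h₁ h₂ (torsionBy R N₃ t).subtype hι
      (Ideal.span {t} • ⊤ : Submodule R N₁).mkQ hπ hg hf
    have ex₂ : Exact F δ :=
      SnakeLemma.exact_δ'_right i₁ i₂ i₃ f g hfg f g hfg h₁ h₂ (torsionBy R N₂ t).subtype hι
        (torsionBy R N₃ t).subtype hι _ hπ hg hf F hF Subtype.val_injective
    have ex₃ : Exact δ G :=
      SnakeLemma.exact_δ'_left i₁ i₂ i₃ f g hfg f g hfg h₁ h₂ (torsionBy R N₃ t).subtype hι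
        _ hπ (Ideal.span {t} • ⊤ : Submodule R N₂).mkQ hπ hg hf G hG
        (Submodule.mkQ_surjective _)
    have hF₀ : Injective F₀ := fun x y hxy => Subtype.ext (hf (congrArg Subtype.val hxy))
    have ex₁ : Exact F₀ F := by
      intro y
      constructor
      · intro hy
        have hgy : g (y : N₂) = 0 := congrArg Subtype.val hy
        obtain ⟨x, hx⟩ := (hfg (y : N₂)).mp hgy
        have hxt : x ∈ torsionBy R N₁ t := by
          rw [mem_torsionBy_iff]
          apply hf
          rw [map_smul, hx, map_zero]
          exact (mem_torsionBy_iff t (y : N₂)).mp y.2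
        exact ⟨⟨x, hxt⟩, Subtype.ext hx⟩
      · rintro ⟨x, rfl⟩
        exact Subtype.ext (hfg.apply_apply_eq_zero (x : N₁))
    have ex₄ : Exact G G₂ := by
      intro z
      constructor
      · intro hz
        obtain ⟨y, rfl⟩ := Submodule.mkQ_surjective _ z
        have hz' : (Ideal.span {t} • ⊤ : Submodule R N₃).mkQ (g y) = 0 := hz
        obtain ⟨b, hb⟩ := (hπ (g y)).mp hz'
        obtain ⟨y', rfl⟩ := hg b
        have hker : g (y - t • y') = 0 := by
          rw [map_sub, map_smul, ← hb]; simp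
        obtain ⟨x, hx⟩ := (hfg _).mp hker
        refine ⟨(Ideal.span {t} • ⊤ : Submodule R N₁).mkQ x, ?_⟩
        change (Ideal.span {t} • ⊤ : Submodule R N₂).mkQ (f x) = (Ideal.span {t} • ⊤ : Submodule R N₂).mkQ y
        rw [hx, map_sub, sub_eq_self]
        exact (hπ (t • y')).mpr ⟨y', by simp⟩
      · rintro ⟨w, rfl⟩
        obtain ⟨x, rfl⟩ := Submodule.mkQ_surjective _ w
        change (Ideal.span {t} • ⊤ : Submodule R N₃).mkQ (g (f x)) = 0
        rw [hfg.apply_apply_eq_zero, map_zero]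
    have hG₂ : Surjective G₂ := by
      intro w
      obtain ⟨z, rfl⟩ := Submodule.mkQ_surjective _ w
      obtain ⟨y, rfl⟩ := hg z
      exact ⟨(Ideal.span {t} • ⊤ : Submodule R N₂).mkQ y, rfl⟩
    -- pass to `R/(t)`-linear maps and count ranks
    haveI : Module.Finite (R ⧸ Ideal.span {t}) (torsionBy R N₁ t) :=
      Module.Finite.of_restrictScalars_finite R _ _
    haveI : Module.Finite (R ⧸ Ideal.span {t}) (torsionBy R N₂ t) :=
      Module.Finite.of_restrictScalars_finite R _ _
    haveI : Module.Finite (R ⧸ Ideal.span {t}) (torsionBy R N₃ t) :=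
      Module.Finite.of_restrictScalars_finite R _ _
    have h6 := finrank_alternatingSum_six_eq_zero (A := R ⧸ Ideal.span {t})
      (F₀.extendScalarsOfSurjective hs) (F.extendScalarsOfSurjective hs)
      (δ.extendScalarsOfSurjective hs) (G.extendScalarsOfSurjective hs)
      (G₂.extendScalarsOfSurjective hs) hF₀ ex₁ ex₂ ex₃ ex₄ hG₂
    rw [hR, E₁, E₃]
    linarith

end RankFormula

end Literature.Algebra.Module
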